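import Literature.Probability.LatticeModels.Sweep1Proofs
import Literature.Probability.LatticeModels.RandomClusterDomainToBox
import Literature.Probability.LatticeModels.IsingPlusEdwardsSokal
import Literature.Probability.LatticeModels.GKSInequalities
import HarnessLib

/-!
# Smirnov's a priori estimate (crit-ising.S18, node 4): the passage probability of an edge far
# from the wired arc

Sibling proof file of `Sweep1Proofs.lean` (whose Part II vendors the named fact
`fkInterface_passageProb_le` = S. Smirnov, Ann. of Math. 172 (2010), Appendix A, Lemma A.1, and
whose Appendix A proves the first sentence of its proof). This file carries out the displayed
chain of the printed proof for an edge `r`-away from the **wired** arc,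

  `P(e ∈ γ) ≤ P(B ↔ wired arc) ≤ P(B ↔ ∂Q inside Ω; …) ≤ … ≤ P(B ↔ ∂Q inside Q; ∂Q wired)`,

for H21's objects: `real_mem_fkInterface_le` bounds the `fkDobrushinMeasure E`-probability that
the FK interface passes through an edge `z` of `Ω_δ`, all of whose endpoints are at sup-distance
`> n` from the discrete arc `A`, by `2 φ¹_{Λ_{n+1},p_c,2}(0 ↔ ∂Λ_{n+1})`
(`thetaWiredBox 2 criticalFKIsingParam 2 (n + 1)`), and `passageProb_le_of_infDist_arcA` turns this
into the `ρ_r(δ) → 0` form of Lemma A.1 *conditionally on* the decay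
`φ¹_{Λ_n,p_c,2}(0 ↔ ∂Λ_n) → 0` — which is the last line of the printed proof ("= magnetization …
computed by Kaufman–Onsager and Yang, tends to zero"): by `IsingPlusEdwardsSokal` it is the
plus-boundary critical magnetisation of the box, whose vanishing in the limit is the tree's
(unproved) named fact `spontaneousMagnetization_two_criticalBetaTwo` (Yang 1952).

Ingredients: `Sweep1Proofs` Appendix A (`exists_reachable_zdArcA_of_mem_fkInterface`: an endpoint
of an interface edge is joined to the arc `A` by open edges of the completed configuration); a
first-exit argument (`exists_armEvent_of_walk`: before meeting an `A`-site the path uses `ω`-open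
lattice edges, so it produces the arm event `armEvent v n` around an endpoint `v`); the
identification of `fkDobrushinMeasure E` with the random-cluster measure of the interface graph
(`fkDobrushinMeasure_real_eq`); and the general comparison `rcMeasure_real_domainArmEvent_le` of
`RandomClusterDomainToBox` (one Holley application).

Second instalment (sections `Decay`, `Halves`): `thetaWiredBox_criticalFKIsing_tendsto_zero` derives
the decay `φ¹_{Λ_n,p_c,2}(0 ↔ ∂Λ_n) → 0` from `IsingPlusEdwardsSokal` (`φ¹` box `=` plus-boundary
magnetisation), the existence of the plus state along boxes (`hasBoxLimit_isingCorr_plus_holds`)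
and Yang's theorem as the hypothesis `spontaneousMagnetization_two_criticalBetaTwo`;
`fkInterface_passageProb_le_arcA_of_yang` is then the wired-arc half of the vendored fact with its
exact quantifier structure, and `fkInterface_passageProb_le_of_halves` records that the fact is the
conjunction of this half with its free-arc twin.

Not here: the free-arc half (dual arm; needs the planar self-duality of the FK measure, Grimmett
2006 §6.1/Thm. 6.13, absent from the tree), hence no unconditional discharge (which moreover needs
Yang's theorem, an unproved named fact of `PlanarIsing.lean`).

## References

* S. Smirnov, Ann. of Math. 172 (2010) 1435–1467, Appendix A, Lemma A.1 and its proof; Rem. 4.9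
  ("the only way the shape of `Ω` enters is via `r`") — bib key `Smirnov2010`.
* G. Grimmett, *The Random-Cluster Model* (2006), Lemma (4.13), Thm. (3.21), Prop. (5.11) — bib key
  `Grimmett2006`.
-/

noncomputable section

namespace Literature.Probability.LatticeModels

open MeasureTheory SimpleGraph Filter
open _root_.Topology
open Literature.Barriers.CriticalPhenomena

section PassageBound

/-- The arm event around the site `v` at scale `n`, on configurations of `ℤ²`: `v` is joined to a
site of the sphere `v + ∂Λ_{n+1}` by configuration edges with both endpoints in the ball
`v + Λ_{n+1}`. [cite: Smirnov2010, Appendix A, proof of Lemma A.1 ("B connected to ∂Q inside Ω")] -/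
def armEvent (v : Site 2) (n : ℕ) : Set (Percolation.BondConfig (Site 2)) :=
  {ω | ∃ s : Site 2, s - v ∈ innerBoundary (zdGraph 2) (box 2 (n + 1)) ∧
    (fromEdgeSet {e | e ∈ ω ∧ ∀ x ∈ e, x - v ∈ box 2 (n + 1)}).Reachable v s}

/-- **First exit.** An open path of the completed configuration `E.bcBondConfig ω` from a site `x`
of the open box `v + Λ_n` to a site `a` off that box produces the arm event around `v` for `ω`
itself, provided no site of the discrete arc `A` lies in `v + Λ_n`: before its first exit from
`v + Λ_n` the path uses only edges with an endpoint off `A`, which are `ω`-open, and lattice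
edges, which stay in `v + Λ_{n+1}`. [cite: Smirnov2010, Appendix A, proof of Lemma A.1] -/
theorem exists_armEvent_of_walk {E : DiscreteDobrushin} {ω : Percolation.BondConfig (Site 2)} {v : Site 2}
    {n : ℕ} (hA : ∀ a ∈ E.zdArcA, a - v ∉ box 2 n) {x a : Site 2}
    (p : (Percolation.openGraph (E.bcBondConfig ω)).Walk x a) (hx : x - v ∈ box 2 n) (ha : a - v ∉ box 2 n) :
    ∃ s : Site 2, s - v ∈ innerBoundary (zdGraph 2) (box 2 (n + 1)) ∧
      (fromEdgeSet {e | e ∈ ω ∧ ∀ y ∈ e, y - v ∈ box 2 (n + 1)}).Reachable x s := by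
  induction p with
  | nil => exact absurd hx ha
  | @cons x x' _ hadj _ ih =>
    rw [Percolation.openGraph_adj] at hadj
    obtain ⟨hopen, hne⟩ := hadj
    -- the edge is an edge of `Ω_δ`, hence a lattice edge, and it is `ω`-open
    have hbc := hopen
    rw [DiscreteDobrushin.mem_bcBondConfig_iff] at hbc
    obtain ⟨hedge, hcases⟩ := hbc
    have hlat : (zdGraph 2).Adj x x' :=
      meshGraph_le_zdGraph _ _ (discreteDomainGraph_le_meshGraph _ _ hedge)
    have hxA : x ∉ E.zdArcA := fun h => hA x h hx
    have hω : s(x, x') ∈ ω := by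
      rcases hcases with hall | ⟨hω, -⟩
      · exact absurd (hall x (Sym2.mem_mk_left _ _)) hxA
      · exact hω
    have hx'box : x' - v ∈ box 2 (n + 1) :=
      mem_box_succ_of_adj ((zdGraph_adj_sub_iff x x' v).2 hlat) hx
    have hxbox : x - v ∈ box 2 (n + 1) := box_mono 2 (Nat.le_succ n) hx
    have hstep : (fromEdgeSet {e | e ∈ ω ∧ ∀ y ∈ e, y - v ∈ box 2 (n + 1)}).Adj x x' := by
      rw [fromEdgeSet_adj]
      refine ⟨⟨hω, fun y hy => ?_⟩, hne⟩
      rcases Sym2.mem_iff.1 hy with rfl | rfl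
      · exact hxbox
      · exact hx'box
    by_cases hx' : x' - v ∈ box 2 n
    · obtain ⟨s, hs, hreach⟩ := ih hx' ha
      exact ⟨s, hs, hstep.reachable.trans hreach⟩
    · exact ⟨x', mem_innerBoundary_box_succ_of_notMem hx'box hx', hstep.reachable⟩

/-- **An interface edge far from the wired arc produces an arm event** (Smirnov 2010, App. A, proof of
Lemma A.1: "`B` is connected by a cluster to the arc `ba` … [hence] to `∂Q` inside `Ω`"): for
admissible data, if `z` lies on the FK interface and no site of the discrete arc `A` is at
sup-distance `≤ n` from an endpoint of `z`, then the arm event at scale `n` holds around some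
endpoint of `z`, for the configuration itself. [cite: Smirnov2010, Appendix A, proof of Lemma A.1] -/
theorem exists_armEvent_of_mem_fkInterface {E : DiscreteDobrushin} (hE : E.IsZdAdmissible)
    {ω : Percolation.BondConfig (Site 2)} {z : MedialVertex} (hz : z ∈ fkInterface E ω) {n : ℕ}
    (hA : ∀ v ∈ z, ∀ a ∈ E.zdArcA, a - v ∉ box 2 n) : ∃ v ∈ z, ω ∈ armEvent v n := by
  obtain ⟨v, hv, a, ha, hreach⟩ := exists_reachable_zdArcA_of_mem_fkInterface hE hz
  obtain ⟨p⟩ := hreach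
  have h0 : v - v ∈ box 2 n := by rw [sub_self]; exact zero_mem_box 2 n
  obtain ⟨s, hs, hr⟩ := exists_armEvent_of_walk (hA v hv) p h0 (hA v hv a ha)
  exact ⟨v, hv, s, hs, hr⟩

/-- The interface graph of `Ω_δ` is embedded in `ℤ²` by the inclusion of its vertex set: its edges
are lattice edges. [cite: Smirnov2010, §2.1] -/
theorem interfaceGraph_adj_zdGraph (E : DiscreteDobrushin) {x y : meshDomain E.Ω E.δ}
    (h : E.interfaceGraph.Adj x y) : (zdGraph 2).Adj x.1 y.1 := by
  have h' : (domainSubgraph E.Ω E.δ).Adj x y := (SimpleGraph.deleteEdges_le _) h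
  exact meshGraph_le_zdGraph _ _ (discreteDomainGraph_le_meshGraph _ _ h')

/-- **`fkDobrushinMeasure` is the random-cluster measure of the interface graph.** For bounded `Ω`
and `δ > 0`, the probability of an event `S` of lattice configurations under `fkDobrushinMeasure E`
is the `φ^{A}_{G,p_c,2}`-probability (`rcMeasure` of the interface graph `G = E.interfaceGraph`,
wired on the arc `A`) of the configurations of `G` whose image in `ℤ²` lies in `S`.
[cite: Smirnov2010, §2.1–2.2] -/
theorem fkDobrushinMeasure_real_eq (E : DiscreteDobrushin) (hΩ : Bornology.IsBounded E.Ω) (hδ : 0 < E.δ)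
    (S : Set (Percolation.BondConfig (Site 2))) :
    letI : Fintype (meshDomain E.Ω E.δ) := (meshDomain_finite hΩ hδ).fintype
    (fkDobrushinMeasure E).real S =
      (@rcMeasure _ _ _ E.interfaceGraph (Classical.decRel _) criticalFKIsingParam 2
        (Subtype.val ⁻¹' E.zdArcA)).real
        {ω | Sym2.map Subtype.val '' ω ∈ S} := by
  classical
  letI : Fintype (meshDomain E.Ω E.δ) := (meshDomain_finite hΩ hδ).fintype
  have hp := criticalFKIsingParam_mem_Icc
  have hZ := rcPartitionFunction_pos E.interfaceGraph hp two_pos (Subtype.val ⁻¹' E.zdArcA)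
  rw [fkDobrushinMeasure_of_pos E hΩ hδ, rcMeasure_real_apply _ hp two_pos]
  -- evaluate the finite sum of Dirac masses
  simp only [DiscreteDobrushin.fkInterfaceMeasure, measureReal_def, Measure.coe_finsetSum,
    Measure.coe_smul, Finset.sum_apply, Pi.smul_apply, smul_eq_mul, Measure.dirac_apply,
    Set.indicator_apply, Pi.one_apply, mul_ite, mul_one, mul_zero]
  rw [ENNReal.toReal_sum (fun ω _ => by split_ifs <;> simp)]
  refine Finset.sum_congr rfl fun ω _ => ?_
  have hnn : 0 ≤ rcWeight E.interfaceGraph criticalFKIsingParam 2 (Subtype.val ⁻¹' E.zdArcA) ω /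
      rcPartitionFunction E.interfaceGraph criticalFKIsingParam 2 (Subtype.val ⁻¹' E.zdArcA) :=
    div_nonneg (rcWeight_nonneg _ hp zero_le_two _ ω) hZ.le
  have hiff : liftConfig E.Ω E.δ ω ∈ S ↔
      (↑ω : Percolation.BondConfig (meshDomain E.Ω E.δ)) ∈ {ω' | Sym2.map Subtype.val '' ω' ∈ S} := Iff.rfl
  by_cases h : liftConfig E.Ω E.δ ω ∈ S
  · rw [if_pos h, if_pos (hiff.1 h), ENNReal.toReal_ofReal hnn]
  · rw [if_neg h, if_neg (fun h' => h (hiff.2 h')), ENNReal.toReal_zero]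

/-- Reading the arm event of `ℤ²` on lifted configurations of the interface graph gives the arm
event of the domain (for the inclusion `Subtype.val`). [folklore] -/
theorem mem_domainArmEvent_of_image_mem_armEvent {E : DiscreteDobrushin} [Fintype (meshDomain E.Ω E.δ)]
    {v : meshDomain E.Ω E.δ} {n : ℕ} {ω : Percolation.BondConfig (meshDomain E.Ω E.δ)}
    (h : Sym2.map Subtype.val '' ω ∈ armEvent v.1 n) :
    ω ∈ domainArmEvent (Function.Embedding.subtype _) n v := by
  obtain ⟨s, hs, hreach⟩ := h
  -- the restricted lattice graph is the image of the restricted domain graph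
  have key : {e | e ∈ Sym2.map Subtype.val '' ω ∧ ∀ x ∈ e, x - v.1 ∈ box 2 (n + 1)} =
      Sym2.map (Function.Embedding.subtype _) ''
        {e | e ∈ ω ∧ ∀ x ∈ e, (Function.Embedding.subtype _ x : Site 2) - v.1 ∈ box 2 (n + 1)} := by
    ext e
    constructor
    · rintro ⟨⟨e', he', rfl⟩, hbox⟩
      refine ⟨e', ⟨he', fun x hx => hbox x.1 ?_⟩, rfl⟩
      exact Sym2.mem_map.2 ⟨x, hx, rfl⟩
    · rintro ⟨e', ⟨he', hbox⟩, rfl⟩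
      refine ⟨⟨e', he', rfl⟩, fun x hx => ?_⟩
      obtain ⟨y, hy, rfl⟩ := Sym2.mem_map.1 hx
      exact hbox y hy
  rw [key, fromEdgeSet_image_eq_map] at hreach
  obtain ⟨y, rfl, hy⟩ := exists_of_reachable_map (Function.Embedding.subtype _) _ hreach
  exact ⟨y, hs, hy⟩

/-- **The passage probability of an edge far from the wired arc, down to the wired box**
(Smirnov 2010, Appendix A, proof of Lemma A.1, the displayed chain up to its last line). For
admissible discrete Dobrushin data `E` and an edge `z` of `Ω_δ` none of whose endpoints is at
sup-distance `≤ n` from a site of the discrete arc `A`, the `fkDobrushinMeasure E`-probability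
that the FK interface passes through `z` is at most `2 φ¹_{Λ_{n+1},p_c,2}(0 ↔ ∂Λ_{n+1})`.
[cite: Smirnov2010, Appendix A, proof of Lemma A.1] -/
theorem real_mem_fkInterface_le {E : DiscreteDobrushin} (hE : E.IsZdAdmissible) {z : MedialVertex}
    (hz : z ∈ (discreteDomainGraph E.Ω E.δ).edgeSet) {n : ℕ}
    (hA : ∀ v ∈ z, ∀ a ∈ E.zdArcA, a - v ∉ box 2 n) :
    (fkDobrushinMeasure E).real {ω | z ∈ fkInterface E ω} ≤
      2 * thetaWiredBox 2 criticalFKIsingParam 2 (n + 1) := by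
  classical
  letI : Fintype (meshDomain E.Ω E.δ) := (meshDomain_finite hE.isBounded hE.delta_pos).fintype
  -- one arm event per endpoint
  have hbound : ∀ v ∈ z, (fkDobrushinMeasure E).real (armEvent v n) ≤
      thetaWiredBox 2 criticalFKIsingParam 2 (n + 1) := by
    intro v hv
    have hvΩ : v ∈ meshDomain E.Ω E.δ := by
      induction z using Sym2.ind with
      | h a b =>
        have hab := (discreteDomainGraph_adj_iff.1 hz)
        rcases Sym2.mem_iff.1 hv with rfl | rfl
        · exact hab.2.1
        · exact hab.2.2
    rw [fkDobrushinMeasure_real_eq E hE.isBounded hE.delta_pos]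
    haveI := isProbabilityMeasure_rcMeasure E.interfaceGraph criticalFKIsingParam_mem_Icc two_pos
      (Subtype.val ⁻¹' E.zdArcA)
    refine (measureReal_mono (fun ω hω => mem_domainArmEvent_of_image_mem_armEvent (v := ⟨v, hvΩ⟩) hω)
      (measure_ne_top _ _)).trans ?_
    refine rcMeasure_real_domainArmEvent_le (ι := Function.Embedding.subtype _)
      (fun x y h => interfaceGraph_adj_zdGraph E h) ⟨v, hvΩ⟩ (fun b hb => hA v hv b.1 hb)
      criticalFKIsingParam_mem_Icc (by norm_num)
  have hsub : {ω | z ∈ fkInterface E ω} ⊆ ⋃ v ∈ ({x | x ∈ z} : Set (Site 2)), armEvent v n := by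
    intro ω hω
    obtain ⟨v, hv, hωv⟩ := exists_armEvent_of_mem_fkInterface hE hω hA
    exact Set.mem_biUnion hv hωv
  induction z using Sym2.ind with
  | h a b =>
    have hset : ({x | x ∈ s(a, b)} : Set (Site 2)) = {a, b} := by
      ext x; simp
    rw [hset] at hsub
    calc (fkDobrushinMeasure E).real {ω | s(a, b) ∈ fkInterface E ω}
        ≤ (fkDobrushinMeasure E).real (⋃ v ∈ ({a, b} : Set (Site 2)), armEvent v n) :=
          measureReal_mono hsub (measure_ne_top _ _)
      _ ≤ (fkDobrushinMeasure E).real (armEvent a n) + (fkDobrushinMeasure E).real (armEvent b n) := by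
          rw [Set.biUnion_pair]
          exact measureReal_union_le _ _
      _ ≤ thetaWiredBox 2 criticalFKIsingParam 2 (n + 1) +
            thetaWiredBox 2 criticalFKIsingParam 2 (n + 1) :=
          add_le_add (hbound a (Sym2.mem_mk_left _ _)) (hbound b (Sym2.mem_mk_right _ _))
      _ = 2 * thetaWiredBox 2 criticalFKIsingParam 2 (n + 1) := by ring

/-! ### The a priori estimate away from the wired arc, given the decay of the wired one-arm probability -/

/-- Lattice neighbours have mesh points with coordinates at most `δ` apart. [folklore] -/
theorem abs_re_im_meshPoint_sub_le_of_adj {δ : ℝ} (hδ : 0 ≤ δ) {x y : Site 2} (h : (zdGraph 2).Adj x y) :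
    |(meshPoint δ x - meshPoint δ y).re| ≤ δ ∧ |(meshPoint δ x - meshPoint δ y).im| ≤ δ := by
  have key : ∀ j : Fin 2, |((x j : ℤ) : ℝ) - (y j : ℝ)| ≤ 1 := by
    intro j
    rcases (zdGraph_adj_iff x y).1 h with ⟨i, rfl | rfl⟩
    · by_cases hji : j = i
      · subst hji; simp
      · simp [Pi.single_eq_of_ne hji]
    · by_cases hji : j = i
      · subst hji; simp
      · simp [Pi.single_eq_of_ne hji]
  constructor
  · rw [Complex.sub_re, meshPoint_re, meshPoint_re, ← mul_sub, abs_mul, abs_of_nonneg hδ]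
    exact mul_le_of_le_one_right hδ (key 0)
  · rw [Complex.sub_im, meshPoint_im, meshPoint_im, ← mul_sub, abs_mul, abs_of_nonneg hδ]
    exact mul_le_of_le_one_right hδ (key 1)

/-- An endpoint of a lattice edge is within `δ` of its midpoint (in fact at distance `δ/2`).
[folklore] -/
theorem dist_meshPoint_medialPoint_le {δ : ℝ} (hδ : 0 ≤ δ) {z : MedialVertex}
    (hz : z ∈ (zdGraph 2).edgeSet) {v : Site 2} (hv : v ∈ z) :
    dist (meshPoint δ v) (medialPoint δ z) ≤ δ := by
  induction z using Sym2.ind with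
  | h x y =>
    rw [SimpleGraph.mem_edgeSet] at hz
    -- reduce to `v = x` by symmetry
    wlog hvx : v = x generalizing x y
    · have hvy : v = y := ((Sym2.mem_iff.1 hv).resolve_left hvx)
      rw [Sym2.eq_swap]
      exact this y x hz.symm (Sym2.eq_swap ▸ hv) hvy
    subst hvx
    obtain ⟨hre, him⟩ := abs_re_im_meshPoint_sub_le_of_adj hδ hz
    rw [medialPoint_mk, Complex.dist_eq]
    have : meshPoint δ v - (meshPoint δ v + meshPoint δ y) / 2 = (meshPoint δ v - meshPoint δ y) / 2 := by ring
    rw [this, norm_div, Complex.norm_two]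
    calc ‖meshPoint δ v - meshPoint δ y‖ / 2
        ≤ (|(meshPoint δ v - meshPoint δ y).re| + |(meshPoint δ v - meshPoint δ y).im|) / 2 := by
          gcongr; exact Complex.norm_le_abs_re_add_abs_im _
      _ ≤ (δ + δ) / 2 := by gcongr
      _ = δ := by ring

/-- Sites whose difference lies in `Λ_N` have mesh points within `2δN`. [folklore] -/
theorem dist_meshPoint_le_of_sub_mem_box {δ : ℝ} (hδ : 0 ≤ δ) {a v : Site 2} {N : ℕ}
    (h : a - v ∈ box 2 N) : dist (meshPoint δ a) (meshPoint δ v) ≤ 2 * δ * N := by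
  have key : ∀ j : Fin 2, |((a j : ℤ) : ℝ) - (v j : ℝ)| ≤ N := by
    intro j
    have := (mem_box.1 h) j
    rw [Pi.sub_apply] at this
    rw [← Int.cast_sub, ← Int.cast_abs]
    exact_mod_cast abs_le.2 ⟨this.1, this.2⟩
  have hre : |(meshPoint δ a - meshPoint δ v).re| ≤ δ * N := by
    rw [Complex.sub_re, meshPoint_re, meshPoint_re, ← mul_sub, abs_mul, abs_of_nonneg hδ]
    exact mul_le_mul_of_nonneg_left (key 0) hδ
  have him : |(meshPoint δ a - meshPoint δ v).im| ≤ δ * N := by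
    rw [Complex.sub_im, meshPoint_im, meshPoint_im, ← mul_sub, abs_mul, abs_of_nonneg hδ]
    exact mul_le_mul_of_nonneg_left (key 1) hδ
  rw [Complex.dist_eq]
  calc ‖meshPoint δ a - meshPoint δ v‖
      ≤ |(meshPoint δ a - meshPoint δ v).re| + |(meshPoint δ a - meshPoint δ v).im| :=
        Complex.norm_le_abs_re_add_abs_im _
    _ ≤ δ * N + δ * N := add_le_add hre him
    _ = 2 * δ * N := by ring

/-- **The a priori estimate away from the wired arc, conditional on the decay of the wired
one-arm probability** (Smirnov 2010, Appendix A, Lemma A.1, the case "`e` is `r` away from the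
wired arc", for H21's `fkDobrushinMeasure`). If `φ¹_{Λ_n,p_c,2}(0 ↔ ∂Λ_n) → 0` as `n → ∞` (the
last line of the printed proof: `=` the critical Ising magnetisation of the box with `+` boundary
conditions, which tends to zero by Kaufman–Onsager–Yang — the tree's unproved fact
`spontaneousMagnetization_two_criticalBetaTwo` together with Edwards–Sokal), then for every `r > 0`
there is `ρ_r` with `ρ_r(δ) → 0` as `δ → 0⁺` such that, for all admissible discrete Dobrushin data
`E` and every edge `z` of `Ω_δ` at Euclidean distance `≥ r` from the mesh points of the discrete
arc `A`, the probability that the FK interface passes through `z` is at most `ρ_r(E.δ)`. No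
hypothesis on the shape of `Ω` is needed (Smirnov's Rem. 4.9). [cite: Smirnov2010, Appendix A, Lemma A.1; Rem. 4.9] -/
theorem passageProb_le_of_infDist_arcA
    (hθ : Tendsto (fun n : ℕ => thetaWiredBox 2 criticalFKIsingParam 2 n) atTop (𝓝 0))
    {r : ℝ} (hr : 0 < r) :
    ∃ ρ : ℝ → ℝ, Tendsto ρ (𝓝[>] (0 : ℝ)) (𝓝 0) ∧
      ∀ (E : DiscreteDobrushin), E.IsZdAdmissible → ∀ z : MedialVertex,
        z ∈ (discreteDomainGraph E.Ω E.δ).edgeSet →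
        r ≤ Metric.infDist (medialPoint E.δ z) (meshPoint E.δ '' E.zdArcA) →
        (fkDobrushinMeasure E).real {ω | z ∈ fkInterface E ω} ≤ ρ E.δ := by
  classical
  set N : ℝ → ℕ := fun δ => ⌊r / (4 * δ)⌋₊ with hN
  refine ⟨fun δ => if δ < r / 4 then 2 * thetaWiredBox 2 criticalFKIsingParam 2 (N δ + 1) else 1,
    ?_, ?_⟩
  · -- the limit
    have h1 : Tendsto (fun δ : ℝ => r / (4 * δ)) (𝓝[>] (0 : ℝ)) atTop := by
      have : (fun δ : ℝ => r / (4 * δ)) = fun δ => (r / 4) * δ⁻¹ := by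
        funext δ; rw [div_mul_eq_div_div, div_eq_mul_inv]
      rw [this]
      exact tendsto_inv_nhdsGT_zero.const_mul_atTop (by positivity)
    have h2 : Tendsto (fun δ : ℝ => N δ + 1) (𝓝[>] (0 : ℝ)) atTop :=
      tendsto_add_atTop_nat 1 |>.comp (tendsto_nat_floor_atTop.comp h1)
    have h3 : Tendsto (fun δ : ℝ => 2 * thetaWiredBox 2 criticalFKIsingParam 2 (N δ + 1))
        (𝓝[>] (0 : ℝ)) (𝓝 0) := by
      simpa using (hθ.comp h2).const_mul 2
    refine h3.congr' ?_
    filter_upwards [Ioo_mem_nhdsGT (show (0 : ℝ) < r / 4 by positivity)] with δ hδ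
    rw [if_pos hδ.2]
  · intro E hE z hz hdist
    have hδ0 : 0 < E.δ := hE.delta_pos
    show _ ≤ (if E.δ < r / 4 then 2 * thetaWiredBox 2 criticalFKIsingParam 2 (N E.δ + 1) else 1)
    by_cases hδ : E.δ < r / 4
    · rw [if_pos hδ]
      refine real_mem_fkInterface_le hE hz fun v hv a ha hbox => ?_
      have hzlat : z ∈ (zdGraph 2).edgeSet := by
        induction z using Sym2.ind with
        | h x y => exact meshGraph_le_zdGraph _ _ (discreteDomainGraph_le_meshGraph _ _ hz)
      have h1 : dist (meshPoint E.δ v) (medialPoint E.δ z) ≤ E.δ := dist_meshPoint_medialPoint_le hδ0.le hzlat hv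
      have h2 : dist (meshPoint E.δ a) (meshPoint E.δ v) ≤ 2 * E.δ * (N E.δ) :=
        dist_meshPoint_le_of_sub_mem_box hδ0.le hbox
      have h3 : 2 * E.δ * (N E.δ) ≤ r / 2 := by
        have hfl : (N E.δ : ℝ) ≤ r / (4 * E.δ) := Nat.floor_le (by positivity)
        calc 2 * E.δ * (N E.δ) ≤ 2 * E.δ * (r / (4 * E.δ)) := by gcongr
          _ = r / 2 := by field_simp; ring
      have h4 : Metric.infDist (medialPoint E.δ z) (meshPoint E.δ '' E.zdArcA) ≤
          dist (medialPoint E.δ z) (meshPoint E.δ a) :=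
        Metric.infDist_le_dist_of_mem (Set.mem_image_of_mem _ ha)
      have h5 : dist (medialPoint E.δ z) (meshPoint E.δ a) ≤ E.δ + 2 * E.δ * (N E.δ) := by
        calc dist (medialPoint E.δ z) (meshPoint E.δ a)
            ≤ dist (medialPoint E.δ z) (meshPoint E.δ v) + dist (meshPoint E.δ v) (meshPoint E.δ a) :=
              dist_triangle _ _ _
          _ ≤ E.δ + 2 * E.δ * (N E.δ) := by
              rw [_root_.dist_comm] at h1; rw [_root_.dist_comm] at h2; exact add_le_add h1 h2
      linarith
    · rw [if_neg hδ]
      exact measureReal_le_one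

end PassageBound

/-! ### Decay of the wired box one-arm probability at `p_c`, from Yang's theorem -/

section Decay

open Filter
open _root_.Topology

/-- The critical FK-Ising parameter is the Edwards–Sokal image of the critical inverse
temperature: `p_c = √2/(1+√2) = 1 - e^{-2β_c(2)}`, `β_c(2) = ½ log(1+√2)`. [cite: Smirnov2010, §2.1] -/
theorem criticalFKIsingParam_eq_fkIsingParam :
    criticalFKIsingParam = fkIsingParam criticalBetaTwo := by
  rw [criticalFKIsingParam, fkIsingParam, criticalBetaTwo]
  have h : (0 : ℝ) < 1 + Real.sqrt 2 := by positivity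
  rw [show -2 * (Real.log (1 + Real.sqrt 2) / 2) = -Real.log (1 + Real.sqrt 2) by ring, Real.exp_neg,
    Real.exp_log h]
  field_simp
  ring

/-- **The wired one-arm probability of critical FK-Ising boxes tends to zero, given Yang's
theorem** (the last line of Smirnov 2010, App. A, proof of Lemma A.1: "the magnetization at
criticality … tends to zero with the mesh"): `φ¹_{Λ_n,p_c,2}(0 ↔ ∂Λ_n) = ⟨σ_0⟩⁺_{Λ_{n-1};β_c}`
(`thetaWiredBox_succ_eq_isingCorr_plus`) decreases to `⟨σ_0⟩⁺_{β_c} = m*(β_c(2))`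
(`hasBoxLimit_isingCorr_plus_holds`), which vanishes by the tree's named fact
`spontaneousMagnetization_two_criticalBetaTwo` (Yang 1952), taken as a hypothesis.
[cite: Smirnov2010, Appendix A, proof of Lemma A.1 (last line); Yang1952] -/
theorem thetaWiredBox_criticalFKIsing_tendsto_zero (hYang : spontaneousMagnetization_two_criticalBetaTwo) :
    Tendsto (fun n : ℕ => thetaWiredBox 2 criticalFKIsingParam 2 n) atTop (𝓝 0) := by
  have hβ : 0 ≤ criticalBetaTwo := criticalBetaTwo_pos.le
  have hlim := hasBoxLimit_isingCorr_plus_holds (d := 2) hβ le_rfl ({0} : Finset (Site 2))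
  have hval : plusCorr 2 criticalBetaTwo 0 {0} = 0 := by
    rw [plusCorr, show spinProduct ({0} : Finset (Site 2)) = spinAt 0 from
      funext fun s => by simp [spinProduct]]
    exact hYang
  have h1 : Tendsto (fun m : ℕ => thetaWiredBox 2 criticalFKIsingParam 2 (m + 1)) atTop (𝓝 0) := by
    have hfun : (fun m : ℕ => thetaWiredBox 2 criticalFKIsingParam 2 (m + 1)) =
        fun m => isingCorr (zdGraph 2) (box 2 m) criticalBetaTwo 0 .plus {0} := by
      funext m
      rw [criticalFKIsingParam_eq_fkIsingParam, thetaWiredBox_succ_eq_isingCorr_plus two_pos hβ]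
    rw [hfun]
    rw [hval] at hlim
    exact hlim
  exact (tendsto_add_atTop_iff_nat 1).1 h1

end Decay


/-! ### The wired-arc half of `fkInterface_passageProb_le`, given Yang's theorem; the glue of the two halves -/

section Halves

open Filter
open _root_.Topology

/-- **The wired-arc half of Smirnov's a priori estimate, conditional only on Yang's theorem.**
For every `r > 0` there is `ρ_r → 0` (`δ → 0⁺`) such that for all admissible discrete Dobrushin
data `E` discretising a Jordan domain and every edge `z` of `Ω_δ` at distance `≥ r` from the mesh
points of the discrete arc `A` (the wired arc), the passage probability of the FK interface
through `z` is at most `ρ_r(E.δ)`: the case "`e` is `r` away from the wired arc" of Smirnov 2010,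
App. A, Lemma A.1, with exactly the quantifier structure of the vendored fact
`fkInterface_passageProb_le`, proved from `passageProb_le_of_infDist_arcA` and the decay
`thetaWiredBox_criticalFKIsing_tendsto_zero`, whose only non-proved input is the tree's named fact
`spontaneousMagnetization_two_criticalBetaTwo` (Yang 1952 — print: "computed by Kaufman–Onsager and
Yang"). The Jordan-domain hypothesis is not used for this half (Rem. 4.9).
[cite: Smirnov2010, Appendix A, Lemma A.1 (case of the wired arc); Rem. 4.9] -/
theorem fkInterface_passageProb_le_arcA_of_yang (hYang : spontaneousMagnetization_two_criticalBetaTwo) :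
    ∀ r : ℝ, 0 < r → ∃ ρ : ℝ → ℝ, Tendsto ρ (𝓝[>] (0 : ℝ)) (𝓝 0) ∧
      ∀ (D : RandomPlanarGeometry.JordanDomain) (E : DiscreteDobrushin), E.Ω = D.carrier → E.IsZdAdmissible →
        ∀ z : MedialVertex, z ∈ (discreteDomainGraph E.Ω E.δ).edgeSet →
          r ≤ Metric.infDist (medialPoint E.δ z) (meshPoint E.δ '' E.zdArcA) →
          (fkDobrushinMeasure E).real {ω | z ∈ fkInterface E ω} ≤ ρ E.δ := by
  intro r hr
  obtain ⟨ρ, hρ, h⟩ :=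
    passageProb_le_of_infDist_arcA (thetaWiredBox_criticalFKIsing_tendsto_zero hYang) hr
  exact ⟨ρ, hρ, fun _ E _ hE z hz hdist => h E hE z hz hdist⟩

/-- **Glue of the two halves.** `fkInterface_passageProb_le` follows from its wired-arc half (above,
given Yang's theorem) and its free-arc half (the same statement with the discrete arc `B`; in print
"treated similarly with clusters replaced by dual clusters, which leads to the same result since
the model is self-dual" — it needs the planar self-duality of the FK measure, not in the tree),
with `ρ_r = max(ρ_r^A, ρ_r^B)`. Both halves are explicit hypotheses here; nothing is asserted.
[cite: Smirnov2010, Appendix A, Lemma A.1 (proof, the two cases)] -/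
theorem fkInterface_passageProb_le_of_halves
    (hA : ∀ r : ℝ, 0 < r → ∃ ρ : ℝ → ℝ, Tendsto ρ (𝓝[>] (0 : ℝ)) (𝓝 0) ∧
      ∀ (D : RandomPlanarGeometry.JordanDomain) (E : DiscreteDobrushin), E.Ω = D.carrier → E.IsZdAdmissible →
        ∀ z : MedialVertex, z ∈ (discreteDomainGraph E.Ω E.δ).edgeSet →
          r ≤ Metric.infDist (medialPoint E.δ z) (meshPoint E.δ '' E.zdArcA) →
          (fkDobrushinMeasure E).real {ω | z ∈ fkInterface E ω} ≤ ρ E.δ)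
    (hB : ∀ r : ℝ, 0 < r → ∃ ρ : ℝ → ℝ, Tendsto ρ (𝓝[>] (0 : ℝ)) (𝓝 0) ∧
      ∀ (D : RandomPlanarGeometry.JordanDomain) (E : DiscreteDobrushin), E.Ω = D.carrier → E.IsZdAdmissible →
        ∀ z : MedialVertex, z ∈ (discreteDomainGraph E.Ω E.δ).edgeSet →
          r ≤ Metric.infDist (medialPoint E.δ z) (meshPoint E.δ '' E.zdArcB) →
          (fkDobrushinMeasure E).real {ω | z ∈ fkInterface E ω} ≤ ρ E.δ) :
    fkInterface_passageProb_le := by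
  intro r hr
  obtain ⟨ρA, hρA, hA'⟩ := hA r hr
  obtain ⟨ρB, hρB, hB'⟩ := hB r hr
  refine ⟨fun δ => max (ρA δ) (ρB δ), by simpa using hρA.max hρB, ?_⟩
  intro D E hΩ hE z hz hdist
  rcases hdist with h | h
  · exact (hA' D E hΩ hE z hz h).trans (le_max_left _ _)
  · exact (hB' D E hΩ hE z hz h).trans (le_max_right _ _)

end Halves

end Literature.Probability.LatticeModels

end
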